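import Literature.RepresentationTheory.MoeglinVignerasWaldspurger1987.RankOneReflectionOperator
import Literature.NumberTheory.Weil1964.WeilGaussScalarMul
import Literature.NumberTheory.Automorphic.UnitaryGroupLocalNormFormCoercive
import HarnessLib

/-!
# The reflection asymmetry of the finite-level characters of the rank-one oscillator representation:
# `‖tr ω(-z)‖ ≠ ‖tr ω(z)‖` for `z` near `1`

[Weil1964] A. Weil, Acta Math. 111 (1964), Chap. I n° 14 (the modulus of a Gauss integral) with the explicit trace
formula ★ `rankOne_torusTrace_eq_explicit` (`tr(ω_{s₁}(u) | W) = λ |β|^{-1/2} g(β⁻¹(1-a))`): for the reflected point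
`z₁ z = -z` the Schur scalar is `c λ` with `|c| = 1` (★ `rankOne_exists_scalar_negOne`, ★ `rankOne_bigCellOp_negOne_mul`),
`β(-z) = -β(z)` and the Gauss coefficient becomes `-β⁻¹(1+a)`; since `‖g(αx)‖ ‖α‖^{1/2} = ‖g(x)‖` (★
`norm_weilGauss_mul_sqrt_eq`) the two traces have different norms as soon as `‖1+a‖ ≠ ‖1-a‖`.  §1 builds the
**Cayley points** `ζ(x) = (1 + xδ)²/(1 - x²d) ∈ U(J₁)(F_v)` (`rankOne_cayley_*`: coordinates
`a = (1+x²d)/(1-x²d)`, `b = 2x/(1-x²d)`, square `≠ 1` for `x ≠ 0`), for which `1 - a = -2x²d/(1-x²d)` and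
`1 + a = 2/(1-x²d)`; §2 proves the asymmetry (**`rankOne_reflection_asymmetry`**) in exactly the shape of the
hypothesis `hasym` of ★ `TwistedCoinv.finrank_weightSpace_add_eq_one_of_trace_eq_neg` (cell `hodgecm-mathlib`,
SOCKETS-H413 §3 S6 «G2a»).  THEOREMS ONLY; count-neutral; HC_CM is proved only modulo the 7 printed citations until
rung 0 closes.

## References
* [Weil1964] A. Weil, Acta Math. 111 (1964) 143–211, Chap. I n° 14 p. 161–163; n° 13 (16) p. 160.
* [MoeglinVignerasWaldspurger1987] C. Mœglin, M.-F. Vignéras, J.-L. Waldspurger, LNM 1291 (1987), Chap. 2 II.1 (A), II.8.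
* [PlatonovRapinchuk1994] V. Platonov, A. Rapinchuk, *Algebraic groups and number theory* (1994), §6.2 (the Cayley map).
-/

set_option autoImplicit false

noncomputable section

open NumberField IsDedekindDomain Matrix MeasureTheory
open scoped Matrix MatrixGroups NNReal Topology
open Literature.RepresentationTheory Literature.RepresentationTheory.HeisenbergGroup
open Literature.NumberTheory.GelbartRogawski1991.UnitaryDualPair.LocalSplitting
open Literature.NumberTheory.Automorphic Literature.NumberTheory.Automorphic.UnitaryGroup
open Literature.NumberTheory.Automorphic.Liu2021
open Literature.NumberTheory.GaloisRepresentations.IsNonarchimedeanLocalField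
open Literature.NumberTheory.Weil1964

namespace Literature.RepresentationTheory.MoeglinVignerasWaldspurger1987

/-! ## §1 Cayley points of `U(J₁)(F_v)` -/

section Cayley

variable {F : Type} [Field F] [NumberField F] (E : Type) [Field E] [NumberField E] [Algebra F E]
  [Algebra.IsQuadraticExtension F E] (c : E ≃ₐ[F] E) {δ : E} (hcδ : c δ = -δ) (hδ : δ ≠ 0) {d : F}
  (hd : δ * δ = algebraMap F E d) (J₁ : Matrix (Fin 1) (Fin 1) E) (v : HeightOneSpectrum (𝓞 F))

include hcδ hδ hd in
/-- `(1 + xδ)(1 - xδ) = 1 - x²d` in `E_v`. [cite: PlatonovRapinchuk1994, §6.2] -/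
theorem cayley_mul_conj (x : v.adicCompletion F) :
    (1 + toLocalRing E v x * algebraMap E (LocalRing E v) δ) * (1 - toLocalRing E v x * algebraMap E (LocalRing E v) δ) =
      toLocalRing E v (1 - x ^ 2 * (d : v.adicCompletion F)) := by
  have hq := isQuadraticCoordinates_local E v c hcδ hδ hd
  have hδδ := hq.mul_self
  rw [map_sub, map_one, map_mul, map_pow]
  linear_combination (-(toLocalRing E v x) ^ 2) * hδδ

include hcδ hδ hd in
/-- the Cayley unit `ζ(x) = (1 + xδ)² / (1 - x²d)` of `E_v` (for `1 - x²d ≠ 0`), with inverse `(1 - xδ)²/(1 - x²d)`.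
[cite: PlatonovRapinchuk1994, §6.2] -/
theorem cayley_isUnit (x : v.adicCompletion F) (hx : 1 - x ^ 2 * (d : v.adicCompletion F) ≠ 0) :
    toLocalRing E v (1 - x ^ 2 * (d : v.adicCompletion F))⁻¹ * (1 + toLocalRing E v x * algebraMap E (LocalRing E v) δ) ^ 2 *
        (toLocalRing E v (1 - x ^ 2 * (d : v.adicCompletion F))⁻¹ *
          (1 - toLocalRing E v x * algebraMap E (LocalRing E v) δ) ^ 2) = 1 := by
  have h := cayley_mul_conj E c hcδ hδ hd v x
  have hk : toLocalRing E v (1 - x ^ 2 * (d : v.adicCompletion F))⁻¹ * toLocalRing E v (1 - x ^ 2 * (d : v.adicCompletion F)) = 1 := by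
    rw [← map_mul, inv_mul_cancel₀ hx, map_one]
  calc _ = (toLocalRing E v (1 - x ^ 2 * (d : v.adicCompletion F))⁻¹ *
        ((1 + toLocalRing E v x * algebraMap E (LocalRing E v) δ) *
          (1 - toLocalRing E v x * algebraMap E (LocalRing E v) δ))) ^ 2 := by ring
    _ = 1 := by rw [h, hk, one_pow]

omit [Algebra.IsQuadraticExtension F E] in
include hcδ in
/-- `c` sends `(1 + xδ)²/(1 - x²d)` to `(1 - xδ)²/(1 - x²d)`. [cite: PlatonovRapinchuk1994, §6.2] -/
theorem conjLocal_cayley (x : v.adicCompletion F) :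
    conjLocal E c v (toLocalRing E v (1 - x ^ 2 * (d : v.adicCompletion F))⁻¹ *
        (1 + toLocalRing E v x * algebraMap E (LocalRing E v) δ) ^ 2) =
      toLocalRing E v (1 - x ^ 2 * (d : v.adicCompletion F))⁻¹ *
        (1 - toLocalRing E v x * algebraMap E (LocalRing E v) δ) ^ 2 := by
  rw [map_mul, map_pow, map_add, map_one, map_mul, conjLocal_toLocalRing, conjLocal_toLocalRing, conjLocal_algebraMap,
    hcδ, map_neg, mul_neg, ← sub_eq_add_neg]

include hcδ hδ hd in
/-- **the Cayley point `z(x) ∈ U(J₁)(F_v)`**: the norm-one scalar `(1 + xδ)²/(1 - x²d)`.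
[cite: PlatonovRapinchuk1994, §6.2] -/
theorem exists_cayley_unit (x : v.adicCompletion F) (hx : 1 - x ^ 2 * (d : v.adicCompletion F) ≠ 0) :
    ∃ u : (LocalRing E v)ˣ, (u : LocalRing E v) = toLocalRing E v (1 - x ^ 2 * (d : v.adicCompletion F))⁻¹ *
        (1 + toLocalRing E v x * algebraMap E (LocalRing E v) δ) ^ 2 ∧
      (u : LocalRing E v) * conjLocal E c v u = 1 := by
  refine ⟨⟨_, _, cayley_isUnit E c hcδ hδ hd v x hx, by rw [mul_comm]; exact cayley_isUnit E c hcδ hδ hd v x hx⟩, rfl, ?_⟩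
  show toLocalRing E v (1 - x ^ 2 * (d : v.adicCompletion F))⁻¹ * (1 + toLocalRing E v x * algebraMap E (LocalRing E v) δ) ^ 2 *
    conjLocal E c v (toLocalRing E v (1 - x ^ 2 * (d : v.adicCompletion F))⁻¹ *
      (1 + toLocalRing E v x * algebraMap E (LocalRing E v) δ) ^ 2) = 1
  rw [conjLocal_cayley E c hcδ v x]
  exact cayley_isUnit E c hcδ hδ hd v x hx

include hd in
/-- **coordinates of the Cayley scalar**: `(1 + xδ)²/(1 - x²d) = a + bδ` with `a = (1 + x²d)/(1 - x²d)`,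
`b = 2x/(1 - x²d)`. [cite: PlatonovRapinchuk1994, §6.2] -/
theorem cayley_re_im (x : v.adicCompletion F) :
    QuadraticCoordinates.re (quadraticLocalEquiv E v c hcδ hδ).toLinearEquiv.toAddEquiv
        (toLocalRing E v (1 - x ^ 2 * (d : v.adicCompletion F))⁻¹ *
          (1 + toLocalRing E v x * algebraMap E (LocalRing E v) δ) ^ 2) =
        (1 - x ^ 2 * (d : v.adicCompletion F))⁻¹ * (1 + x ^ 2 * (d : v.adicCompletion F)) ∧
      QuadraticCoordinates.im (quadraticLocalEquiv E v c hcδ hδ).toLinearEquiv.toAddEquiv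
        (toLocalRing E v (1 - x ^ 2 * (d : v.adicCompletion F))⁻¹ *
          (1 + toLocalRing E v x * algebraMap E (LocalRing E v) δ) ^ 2) =
        (1 - x ^ 2 * (d : v.adicCompletion F))⁻¹ * (2 * x) := by
  have hq := isQuadraticCoordinates_local E v c hcδ hδ hd
  have hδδ := hq.mul_self
  have e : toLocalRing E v (1 - x ^ 2 * (d : v.adicCompletion F))⁻¹ *
        (1 + toLocalRing E v x * algebraMap E (LocalRing E v) δ) ^ 2 =
      toLocalRing E v ((1 - x ^ 2 * (d : v.adicCompletion F))⁻¹ * (1 + x ^ 2 * (d : v.adicCompletion F))) +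
        toLocalRing E v ((1 - x ^ 2 * (d : v.adicCompletion F))⁻¹ * (2 * x)) * algebraMap E (LocalRing E v) δ := by
    rw [map_mul, map_mul, map_add, map_one, map_mul, map_pow, map_mul, map_ofNat]
    linear_combination (toLocalRing E v (1 - x ^ 2 * (d : v.adicCompletion F))⁻¹ * (toLocalRing E v x) ^ 2) * hδδ
  rw [e]
  exact ⟨hq.re_eq _ _, hq.im_eq _ _⟩

end Cayley

/-! ## §2 The reflection asymmetry -/

section Asymmetry

variable (F : Type) [Field F] [NumberField F] (E : Type) [Field E] [NumberField E] [Algebra F E]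
  [Algebra.IsQuadraticExtension F E] (c : E ≃ₐ[F] E) (δ : E) (hcδ : c δ = -δ) (hδ : δ ≠ 0) (d : F)
  (hd : δ * δ = algebraMap F E d) (t : Matrix (Fin 1) (Fin 1) F) (ht : t.IsSymm) (htd : IsUnit t.det)
  (J₁ : Matrix (Fin 1) (Fin 1) E) (hJ₁ : J₁ = t.map (algebraMap F E)) (v : HeightOneSpectrum (𝓞 F))
  (hE : IsField (UnitaryGroup.LocalRing E v))
  (s₁ : localPi E c 1 J₁ v →* LocalMp F 1 t v)
  (hs₁ : ∀ g, MpPsi.proj _ (s₁ g) = iota F E c 1 hcδ hδ hd t ht hJ₁ v g)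
  (hsm₁ : Representation.IsSmooth ((MpPsi.toRep (localSchrodinger F 1 t v)).comp s₁))

include hd hδ hcδ in
/-- **a Cayley point of square `≠ 1`**: for `x ≠ 0` with `1 - x²d ≠ 0`, the element `z(x)` of `U(J₁)(F_v)` with scalar
`(1+xδ)²/(1-x²d) = a + bδ` has `b = 2x/(1-x²d) ≠ 0`, hence `z(x)² ≠ 1` (`a² - db² = 1` and `z² = 1` would force
`b = 0`). [cite: PlatonovRapinchuk1994, §6.2; Weil1964, n° 7, p. 152] -/
theorem rankOne_cayley_mul_self_ne_one (hJ₁' : J₁ 0 0 ≠ 0) (x : v.adicCompletion F) (hx0 : x ≠ 0)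
    (hx : 1 - x ^ 2 * (d : v.adicCompletion F) ≠ 0) (z : localPi E c 1 J₁ v)
    (hz : (fun w : PlacesOver E v => ((z : LocalGLPi E 1 v) w).val 0 0 : LocalRing E v) =
      toLocalRing E v (1 - x ^ 2 * (d : v.adicCompletion F))⁻¹ * (1 + toLocalRing E v x * algebraMap E (LocalRing E v) δ) ^ 2) :
    z * z ≠ 1 := by
  haveI : CharZero (v.adicCompletion F) := charZero_of_injective_algebraMap (algebraMap F _).injective
  have hq := isQuadraticCoordinates_local E v c hcδ hδ hd
  set Ψ := (quadraticLocalEquiv E v c hcδ hδ).toLinearEquiv.toAddEquiv with hΨ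
  obtain ⟨hre, him⟩ := cayley_re_im E c hcδ hδ hd v x
  set a := QuadraticCoordinates.re Ψ (fun w : PlacesOver E v => ((z : LocalGLPi E 1 v) w).val 0 0) with ha
  set b := QuadraticCoordinates.im Ψ (fun w : PlacesOver E v => ((z : LocalGLPi E 1 v) w).val 0 0) with hb
  have hbval : b = (1 - x ^ 2 * (d : v.adicCompletion F))⁻¹ * (2 * x) := by rw [hb, hz]; exact him
  have hb0 : b ≠ 0 := by rw [hbval]; exact mul_ne_zero (inv_ne_zero hx) (mul_ne_zero two_ne_zero hx0)
  have hnorm := rankOne_re_sq_sub E c J₁ v hJ₁' hcδ hδ hd z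
  rw [← hΨ, ← ha, ← hb] at hnorm
  intro hzz
  have hsc := rankOne_scalar_mul E c J₁ v z z
  rw [hzz] at hsc
  have hone : (fun w : PlacesOver E v => (((1 : localPi E c 1 J₁ v) : LocalGLPi E 1 v) w).val 0 0 : LocalRing E v) = 1 := by
    funext w; exact rankOne_entry_one E c J₁ v w
  rw [hone] at hsc
  have h1 := congrArg (QuadraticCoordinates.re Ψ) hsc
  have h2 := congrArg (QuadraticCoordinates.im Ψ) hsc
  rw [hq.re_one, hq.re_mul, ← ha, ← hb] at h1
  rw [hq.im_one, hq.im_mul, ← ha, ← hb] at h2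
  -- `2ab = 0`, `a² + d b² = 1`, `a² - d b² = 1`
  have hab : a * b = 0 := by linear_combination h2.symm / 2
  rcases mul_eq_zero.1 hab with ha0 | hb00
  · rw [ha0] at h1 hnorm
    have : (2 : v.adicCompletion F) = 0 := by linear_combination h1 - hnorm
    exact two_ne_zero this
  · exact hb0 hb00

include hcδ hδ hd ht htd hJ₁ hE hs₁ hsm₁ in
set_option maxHeartbeats 1600000 in -- MEASURED: two instances of the explicit trace formula in one context; 800 k fails
/-- **THE REFLECTION ASYMMETRY.**  There are `z ∈ U(J₁)(F_v)` and an open subgroup `K₀ ∌ z, z₁z` (`z₁ = -1`) such that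
for every open subgroup `L ≤ K₀` and every finite-dimensional `W = 𝒮^L` stable under `ω_{s₁}(z)`, `ω_{s₁}(z₁z)`:
`‖tr(ω_{s₁}(z₁ z) | W)‖ ≠ ‖tr(ω_{s₁}(z) | W)‖`.  Proof: `z` = a Cayley point with `‖x²d‖ < 1`, so `‖1 - a‖ =
‖2‖‖x²d‖ < ‖2‖ = ‖1 + a‖`; by ★ `rankOne_torusTrace_eq_explicit` at `z` and at `z₁z` (Schur scalars `λ` and `cλ`,
`|c| = 1`; coefficients `β⁻¹(1-a)` and `-β⁻¹(1+a)`) and `‖g(αy)‖‖α‖^{1/2} = ‖g(y)‖` the norms differ.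
[cite: Weil1964, Chap. I n° 14 Thm. 2, p. 161–163; MoeglinVignerasWaldspurger1987, Chap. 2 II.8] -/
theorem rankOne_reflection_asymmetry [MeasurableSpace (v.adicCompletion F)] [BorelSpace (v.adicCompletion F)]
    (μ : Measure (v.adicCompletion F)) [μ.IsAddHaarMeasure] (m : ℤ) (hm : (adeleAddCharAt F v).HasConductorExp m) :
    ∃ z : localPi E c 1 J₁ v, ∃ K₀ : Subgroup (localPi E c 1 J₁ v), IsOpen (K₀ : Set (localPi E c 1 J₁ v)) ∧
      z ∉ K₀ ∧ localUnitScalar E c J₁ v (-1) (negOne_mul_conjLocal_negOne E c v) * z ∉ K₀ ∧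
      ∀ L : Subgroup (localPi E c 1 J₁ v), IsOpen (L : Set (localPi E c 1 J₁ v)) → L ≤ K₀ →
        ∀ (W : Submodule ℂ (SchwartzBruhat (Fin 1 → v.adicCompletion F))) [FiniteDimensional ℂ W],
          (∀ f, f ∈ W ↔ ∀ k ∈ L, ((MpPsi.toRep (localSchrodinger F 1 t v)).comp s₁) k f = f) →
          ∀ (h₁ : ∀ w ∈ W, ((MpPsi.toRep (localSchrodinger F 1 t v)).comp s₁) z w ∈ W)
            (h₂ : ∀ w ∈ W, ((MpPsi.toRep (localSchrodinger F 1 t v)).comp s₁)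
              (localUnitScalar E c J₁ v (-1) (negOne_mul_conjLocal_negOne E c v) * z) w ∈ W),
            ‖LinearMap.trace ℂ W ((((MpPsi.toRep (localSchrodinger F 1 t v)).comp s₁)
                (localUnitScalar E c J₁ v (-1) (negOne_mul_conjLocal_negOne E c v) * z)).restrict h₂)‖ ≠
              ‖LinearMap.trace ℂ W ((((MpPsi.toRep (localSchrodinger F 1 t v)).comp s₁) z).restrict h₁)‖ := by
  classical
  haveI : CharZero (v.adicCompletion F) := charZero_of_injective_algebraMap (algebraMap F _).injective
  have htwo : (2 : v.adicCompletion F) ≠ 0 := two_ne_zero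
  have hψ := isContinuousNontrivial_adeleAddCharAt F v
  have hq := isQuadraticCoordinates_local E v c hcδ hδ hd
  set Ψ := (quadraticLocalEquiv E v c hcδ hδ).toLinearEquiv.toAddEquiv with hΨ
  set z₁ := localUnitScalar E c J₁ v (-1) (negOne_mul_conjLocal_negOne E c v) with hz₁
  set ω := (MpPsi.toRep (localSchrodinger F 1 t v)).comp s₁ with hω
  have hJ₁' : J₁ 0 0 ≠ 0 := by
    rw [hJ₁, Matrix.map_apply, map_ne_zero_iff _ (algebraMap F E).injective, ← Matrix.det_fin_one t]; exact htd.ne_zero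
  have hd0 : (d : v.adicCompletion F) ≠ 0 := by
    have hdF : d ≠ 0 := by
      rintro rfl
      rw [map_zero, mul_self_eq_zero] at hd
      exact hδ hd
    exact map_ne_zero_iff _ (algebraMap F (v.adicCompletion F)).injective |>.2 hdF
  -- ### a small non-zero `x` with `‖x² d‖ < 1`
  obtain ⟨x, hx0, hxd⟩ : ∃ x : v.adicCompletion F, x ≠ 0 ∧ normAbs (v.adicCompletion F) (x ^ 2 * (d : v.adicCompletion F)) < 1 := by
    obtain ⟨x₀, hx₀0, hx₀⟩ := exists_normAbs_eq_inv_zpow_of_int (F := v.adicCompletion F) 1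
    have hq1 : (residueFieldCard (v.adicCompletion F) : ℝ≥0)⁻¹ < 1 :=
      inv_lt_one_of_one_lt₀ (by exact_mod_cast one_lt_residueFieldCard (v.adicCompletion F))
    rw [zpow_one] at hx₀
    by_cases hdle : normAbs (v.adicCompletion F) (d : v.adicCompletion F) ≤ 1
    · refine ⟨x₀, hx₀0, ?_⟩
      rw [map_mul, map_pow, hx₀]
      calc (residueFieldCard (v.adicCompletion F) : ℝ≥0)⁻¹ ^ 2 * normAbs (v.adicCompletion F) (d : v.adicCompletion F)
          ≤ (residueFieldCard (v.adicCompletion F) : ℝ≥0)⁻¹ ^ 2 * 1 := by gcongr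
        _ < 1 := by rw [mul_one]; exact pow_lt_one₀ bot_le hq1 two_ne_zero
    · have hdlt := not_le.1 hdle
      refine ⟨x₀ * (d : v.adicCompletion F)⁻¹, mul_ne_zero hx₀0 (inv_ne_zero hd0), ?_⟩
      have e : (x₀ * (d : v.adicCompletion F)⁻¹) ^ 2 * (d : v.adicCompletion F) = x₀ ^ 2 * (d : v.adicCompletion F)⁻¹ := by
        field_simp
      rw [e, map_mul, map_pow, map_inv₀, hx₀]
      calc (residueFieldCard (v.adicCompletion F) : ℝ≥0)⁻¹ ^ 2 * (normAbs (v.adicCompletion F) (d : v.adicCompletion F))⁻¹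
          ≤ (residueFieldCard (v.adicCompletion F) : ℝ≥0)⁻¹ ^ 2 * 1 := by
            gcongr; exact inv_le_one_of_one_le₀ hdlt.le
        _ < 1 := by rw [mul_one]; exact pow_lt_one₀ bot_le hq1 two_ne_zero
  have h1x : normAbs (v.adicCompletion F) (1 - x ^ 2 * (d : v.adicCompletion F)) = 1 := normAbs_one_sub_eq_one hxd
  have hx : 1 - x ^ 2 * (d : v.adicCompletion F) ≠ 0 := by
    intro h0; rw [h0, map_zero] at h1x; exact zero_ne_one h1x
  -- ### the Cayley point `z` and its coordinates
  obtain ⟨u, hu, hun⟩ := exists_cayley_unit E c hcδ hδ hd v x hx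
  set z : localPi E c 1 J₁ v := localUnitScalar E c J₁ v u hun with hzdef
  have hzsc : (fun w : PlacesOver E v => ((z : LocalGLPi E 1 v) w).val 0 0 : LocalRing E v) =
      toLocalRing E v (1 - x ^ 2 * (d : v.adicCompletion F))⁻¹ * (1 + toLocalRing E v x * algebraMap E (LocalRing E v) δ) ^ 2 := by
    rw [← hu]; funext w; exact coe_localUnitScalar_apply E c J₁ v u hun w
  set a := QuadraticCoordinates.re Ψ (fun w : PlacesOver E v => ((z : LocalGLPi E 1 v) w).val 0 0) with ha
  set b := QuadraticCoordinates.im Ψ (fun w : PlacesOver E v => ((z : LocalGLPi E 1 v) w).val 0 0) with hb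
  obtain ⟨hre, him⟩ := cayley_re_im E c hcδ hδ hd v x
  have haval : a = (1 - x ^ 2 * (d : v.adicCompletion F))⁻¹ * (1 + x ^ 2 * (d : v.adicCompletion F)) := by
    rw [ha, hzsc]; exact hre
  have hbval : b = (1 - x ^ 2 * (d : v.adicCompletion F))⁻¹ * (2 * x) := by rw [hb, hzsc]; exact him
  have hzz : z * z ≠ 1 := rankOne_cayley_mul_self_ne_one F E c δ hcδ hδ d hd J₁ v hJ₁' x hx0 hx z hzsc
  have hcomm := localPi_one_mul_comm E c J₁ v
  have hz₁z₁ : z₁ * z₁ = 1 := localUnitScalar_negOne_mul_self E c J₁ v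
  have hzz' : z₁ * z * (z₁ * z) ≠ 1 := by
    rwa [mul_assoc, ← mul_assoc z z₁ z, hcomm z z₁, mul_assoc, ← mul_assoc, hz₁z₁, one_mul]
  have hz1 : z ≠ 1 := by rintro h; exact hzz (by rw [h, one_mul])
  have hz₁z1 : z₁ * z ≠ 1 := by rintro h; exact hzz' (by rw [h, one_mul])
  -- `1 - a = -2x²d/(1-x²d)`, `1 + a = 2/(1-x²d)`: different absolute values
  have h1a : 1 - a = (1 - x ^ 2 * (d : v.adicCompletion F))⁻¹ * (-(2 * (x ^ 2 * (d : v.adicCompletion F)))) := by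
    rw [haval]; field_simp; ring
  have h1a' : 1 + a = (1 - x ^ 2 * (d : v.adicCompletion F))⁻¹ * 2 := by
    rw [haval]; field_simp; ring
  have hn1a : normAbs (v.adicCompletion F) (1 - a) =
      normAbs (v.adicCompletion F) 2 * normAbs (v.adicCompletion F) (x ^ 2 * (d : v.adicCompletion F)) := by
    rw [h1a, map_mul, map_inv₀, h1x, inv_one, one_mul, normAbs_neg, map_mul]
  have hn1a' : normAbs (v.adicCompletion F) (1 + a) = normAbs (v.adicCompletion F) 2 := by
    rw [h1a', map_mul, map_inv₀, h1x, inv_one, one_mul]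
  have hne : normAbs (v.adicCompletion F) (1 + a) ≠ normAbs (v.adicCompletion F) (1 - a) := by
    rw [hn1a, hn1a']
    intro h
    have h2pos : 0 < normAbs (v.adicCompletion F) (2 : v.adicCompletion F) := by
      rw [pos_iff_ne_zero]; exact (map_ne_zero _).2 htwo
    have h' : normAbs (v.adicCompletion F) 2 * normAbs (v.adicCompletion F) (x ^ 2 * (d : v.adicCompletion F)) =
        normAbs (v.adicCompletion F) 2 * 1 := by rw [mul_one]; exact h.symm
    exact absurd (mul_left_cancel₀ h2pos.ne' h') hxd.ne
  have h1a0 : 1 - a ≠ 0 := by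
    rw [h1a]; exact mul_ne_zero (inv_ne_zero hx) (neg_ne_zero.2 (mul_ne_zero htwo (mul_ne_zero (pow_ne_zero 2 hx0) hd0)))
  have h1a0' : 1 + a ≠ 0 := by rw [h1a']; exact mul_ne_zero (inv_ne_zero hx) htwo
  -- ### the explicit trace formula at `z` and at `z₁ z`
  obtain ⟨K₁, hK₁o, hK₁⟩ :=
    rankOne_torusTrace_eq_explicit F E c δ hcδ hδ d hd t ht htd J₁ hJ₁ v hE s₁ hs₁ hsm₁ z hzz μ m hm
  obtain ⟨K₂, hK₂o, hK₂⟩ :=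
    rankOne_torusTrace_eq_explicit F E c δ hcδ hδ d hd t ht htd J₁ hJ₁ v hE s₁ hs₁ hsm₁ (z₁ * z) hzz' μ m hm
  have E1 := hK₁ 1 K₁.one_mem
  have E2 := hK₂ 1 K₂.one_mem
  rw [mul_one] at E1 E2
  -- coordinates of `z₁ z`
  have ha₂ := rankOne_re_negOne_mul E c J₁ v hcδ hδ z
  have hb₂ := rankOne_im_negOne_mul E c J₁ v hcδ hδ z
  rw [← hz₁, ← hΨ, ← ha] at ha₂; rw [← hz₁, ← hΨ, ← hb] at hb₂
  obtain ⟨hβ0, hT1⟩ := E1 a b rfl rfl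
  obtain ⟨-, hT2⟩ := E2 (-a) (-b) ha₂.symm hb₂.symm
  -- ### an open subgroup avoiding `z` and `z₁ z`
  have hO : (({z}ᶜ ∩ {z₁ * z}ᶜ : Set (localPi E c 1 J₁ v))) ∈ 𝓝 (1 : localPi E c 1 J₁ v) :=
    (isOpen_compl_singleton.inter isOpen_compl_singleton).mem_nhds ⟨fun h => hz1 h.symm, fun h => hz₁z1 h.symm⟩
  obtain ⟨K₃, hK₃o, hK₃O⟩ := rankOne_exists_openSubgroup_subset E c hcδ hδ t htd hJ₁ v hE hO
  refine ⟨z, K₁ ⊓ K₂ ⊓ K₃, ?_, fun h => (hK₃O (Subgroup.mem_inf.1 h).2).1 rfl,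
    fun h => (hK₃O (Subgroup.mem_inf.1 h).2).2 rfl, ?_⟩
  · rw [Subgroup.coe_inf, Subgroup.coe_inf]; exact (hK₁o.inter hK₂o).inter hK₃o
  intro L hLo hLK W _ hW h₁ h₂
  have hL₁ : L ≤ K₁ := hLK.trans (inf_le_left.trans inf_le_left)
  have hL₂ : L ≤ K₂ := hLK.trans (inf_le_left.trans inf_le_right)
  -- ### the Schur scalars: `λ` at `z`, `c λ` at `z₁ z`
  set hl := isLocallyConstant_of_isContinuousNontrivial hψ with hhl
  have hB := rankOne_blockB_bijective E c hcδ hδ hd t ht htd hJ₁ v z _ rfl (by rw [← hΨ, ← hb]; exact hβ0)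
  obtain ⟨lam, hlam⟩ := rankOne_exists_scalar_bigCellWord F E c hcδ hδ hd t ht htd hJ₁ v μ hm s₁ hs₁ z _ rfl hB
  have hlam' : ∀ f : SchwartzBruhat (Fin 1 → v.adicCompletion F), ω z f =
      (lam : ℂ) • bigCellOp hl μ hψ hm
        (symplecticConj (gramProd (localGram F 1 t v) (UnitaryGroup.isUnit_det_map (algebraMap F (v.adicCompletion F)) htd))
          (polar_dotProductBilin_gramProd (localGram F 1 t v) (UnitaryGroup.isUnit_det_map (algebraMap F (v.adicCompletion F)) htd))
          (iota F E c 1 hcδ hδ hd t ht hJ₁ v z)) f := by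
    intro f; rw [bigCellOp_of_bijective hl μ hψ hm _ hB]; exact hlam f
  obtain ⟨cneg, hcneg, hcval⟩ := rankOne_exists_scalar_negOne F E c δ hcδ hδ d hd t ht htd J₁ hJ₁ v s₁ hs₁
  have hneg := rankOne_bigCellOp_negOne_mul E c hcδ hδ hd t ht htd hJ₁ v μ m hm z (by rw [← hΨ, ← hb]; exact hβ0)
  rw [← hz₁] at hneg hcval
  have hlam₂ : ∀ f : SchwartzBruhat (Fin 1 → v.adicCompletion F), ω (z₁ * z) f =
      (cneg * (lam : ℂ)) • bigCellOp hl μ hψ hm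
        (symplecticConj (gramProd (localGram F 1 t v) (UnitaryGroup.isUnit_det_map (algebraMap F (v.adicCompletion F)) htd))
          (polar_dotProductBilin_gramProd (localGram F 1 t v) (UnitaryGroup.isUnit_det_map (algebraMap F (v.adicCompletion F)) htd))
          (iota F E c 1 hcδ hδ hd t ht hJ₁ v (z₁ * z))) f := by
    intro f
    rw [map_mul, Module.End.mul_apply, hlam' f, map_smul, hcval, smul_smul, mul_comm (lam : ℂ) cneg, hneg,
      LinearEquiv.mul_apply]
  -- ### the two traces
  have hτ := hT1 L hLo hL₁ W hW h₁ (lam : ℂ) hlam'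
  have hτ₂ := hT2 L hLo hL₂ W hW h₂ (cneg * (lam : ℂ)) hlam₂
  rw [hτ, hτ₂]
  clear hτ hτ₂ hT1 hT2 E1 E2 hK₁ hK₂ hlam hlam' hlam₂ hcval hneg hW h₁ h₂
  -- ### norms
  obtain ⟨β, hβdef⟩ : ∃ β : v.adicCompletion F, (d : v.adicCompletion F) * b * (localGram F 1 t v 0 0)⁻¹ = β := ⟨_, rfl⟩
  have hβ' : (d : v.adicCompletion F) * -b * (localGram F 1 t v 0 0)⁻¹ = -β := by rw [← hβdef]; ring
  rw [hβ', hβdef]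
  rw [hβdef] at hβ0
  have hcn : ‖cneg‖ = 1 := by
    have h := congrArg (fun w : ℂ => ‖w‖) hcneg
    simp only [norm_mul, norm_one] at h
    nlinarith [norm_nonneg cneg]
  have hA0 : β⁻¹ * (1 - a) ≠ 0 := mul_ne_zero (inv_ne_zero hβ0) h1a0
  have hα0 : -(1 + a) * (1 - a)⁻¹ ≠ 0 := mul_ne_zero (neg_ne_zero.2 h1a0') (inv_ne_zero h1a0)
  have hAA : (-β)⁻¹ * (1 - -a) = (-(1 + a) * (1 - a)⁻¹) * (β⁻¹ * (1 - a)) := by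
    field_simp
    ring
  have hgauss := norm_weilGauss_mul_sqrt_eq F v μ hψ hα0 hA0
  rw [← hAA] at hgauss
  have hg0 : ‖weilGauss (adeleAddCharAt F v) μ (β⁻¹ * (1 - a))‖ ≠ 0 :=
    norm_ne_zero_iff.2 (weilGauss_ne_zero μ hψ hA0 htwo)
  have hsq0 : ((Real.sqrt (normAbs (v.adicCompletion F) β) : ℝ) : ℂ) ≠ 0 := by
    rw [Complex.ofReal_ne_zero]
    have hpos : 0 < normAbs (v.adicCompletion F) β := pos_iff_ne_zero.2 ((map_ne_zero _).2 hβ0)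
    exact (Real.sqrt_pos.2 (by exact_mod_cast hpos)).ne'
  intro habs
  rw [normAbs_neg] at habs
  simp only [norm_mul, norm_inv, hcn, one_mul] at habs
  have hl0 : ‖(lam : ℂ)‖ ≠ 0 := norm_ne_zero_iff.2 lam.ne_zero
  have hs0 : ‖((Real.sqrt (normAbs (v.adicCompletion F) β) : ℝ) : ℂ)‖ ≠ 0 := norm_ne_zero_iff.2 hsq0
  have hgg : ‖weilGauss (adeleAddCharAt F v) μ ((-β)⁻¹ * (1 - -a))‖ = ‖weilGauss (adeleAddCharAt F v) μ (β⁻¹ * (1 - a))‖ := by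
    have := mul_left_cancel₀ (mul_ne_zero hl0 (inv_ne_zero hs0)) habs
    exact this
  rw [hgg] at hgauss
  -- `√‖α‖ = 1`, i.e. `‖1 + a‖ = ‖1 - a‖`
  have hroot : Real.sqrt (normAbs (v.adicCompletion F) (-(1 + a) * (1 - a)⁻¹)) = 1 := by
    have h := hgauss
    conv_rhs at h => rw [← mul_one ‖weilGauss (adeleAddCharAt F v) μ (β⁻¹ * (1 - a))‖]
    exact mul_left_cancel₀ hg0 h
  have hone : normAbs (v.adicCompletion F) (-(1 + a) * (1 - a)⁻¹) = 1 := by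
    have h := congrArg (fun r : ℝ => r ^ 2) hroot
    simp only [Real.sq_sqrt (NNReal.coe_nonneg _), one_pow] at h
    exact_mod_cast h
  rw [map_mul, normAbs_neg, map_inv₀, mul_inv_eq_one₀ ((map_ne_zero _).2 h1a0)] at hone
  exact hne hone

end Asymmetry

end Literature.RepresentationTheory.MoeglinVignerasWaldspurger1987

end
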